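import Literature.NumberTheory.NumberFields.HeckeCharacterRayKernelAvatar
import Summits.BirchSwinnertonDyer.BirchSwinnertonDyer.Theorems.PrintCf2RubinValueTwoAvatarOnRayLocal
import HarnessLib

/-!
# The `p`-adic avatar of an algebraic Hecke character ON THE RAY SUBGROUP `Gal(K̄/K(𝔪))` is within
# `p^{−N}` of the algebraic character of the `v`-adic Artin character — the ARITHMETIC HALF of de Shalit's
# II.4.14 (38) ("`ε ≡ λ^k` on `G_n`"; II.4.13), for any totally complex `K`, any `p`, any avatar

Cell `bsd-print-cf2`, width seat `bsd-line-cf2-p1-w5` g13; construction lane of the print leaf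
`KatzDistributionsAtTwoPrint` (stmt-24720) of crux `PrintCf2.SplitBadTwoRankOneOfFacts` (stmt-20368).
Theorems only (no `def`, no named fact, no `sorry`). BSD is not proved by any of this; 24720 / 20368 are
NOT closed by this file.

## What is in the tree already, and what this file adds

`Literature/NumberTheory/NumberFields/HeckeCharacterRayKernelAvatar.lean` (with `RayClassFieldKernelIdele`,
`LAdicCharacterGlobalValueProofs`) computes the EXACT value of any `p`-adic avatar `r` of a Hecke character
`φ` of infinity type `(pp, qq)` on `σ ∈ Gal(K̄/K(𝔪))` (`K` totally complex, `𝔪 ≠ 0`, `w_𝔪 = 1`, `v ∤ 𝔪`,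
module of definition of `φ` dividing `𝔪` away from `v`):
`avatarValueAt_eq_of_mem_ker_rayClassField` — `φ̂(σ) = (ι⁻¹(φ(⟨κ_v σ⟩_v)) · Λ(e))⁻¹` for a ray idele
`e ∈ W_𝔪`, `e_∞ = 1`, `σ|_{K^ab} = [e, K]`, `e_w = κ_w σ` (`w ∤ 𝔪`), `Λ = PadicEmbedding.algPart ι pp qq`
Serre's algebraic part. THIS FILE turns the exact value into the CONGRUENCE that de Shalit's (38) uses:

* §1 `norm_coe_algPart_eq_one` — `‖Λ(x)‖ = 1` when the components of `x` above `p` are local units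
  (continuous `K_w → ℚ̄_p` send `𝒪_wˣ` to norm `1`, `PrintCf2RubinValueTwoAvatarOnRayLocal`);
  `coe_algPart_inv_localUnits_eq_prod` — the stand-in `Λ(⟨u⟩_v)⁻¹ = ∏_{emb : K_v → ℚ̄_p} emb(u)^{n_emb}`.
* §2 ★★ `norm_avatarValueAt_sub_algPart_inv_localUnits_le` — for `φ` with module of definition
  `(T, c) ≤ 𝔪` (so `φ` is unramified at `v ∤ 𝔪` as far as `𝔪` sees) and `𝔪` deep enough at every OTHER
  place `w ∣ p` that `x_w ≡ 1 mod 𝔪` forces `x_w ≡ 1 mod p^N` (`hdeep`; e.g. `𝔪 = 𝔤·v̄^N` at a split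
  unramified `p = v v̄`):

      ‖φ̂(σ) − Λ(⟨κ_v σ⟩_v)⁻¹‖ ≤ p^{−N}   (σ ∈ Gal(K̄/K(𝔪))),

  with the stand-in `Λ(⟨κ_v σ⟩_v)⁻¹` an algebraic character of `κ_v σ` ALONE — the one-variable `mono`
  of the R220-CUT receptacle `AvatarMonomialCongruence` (`Cruxes/SplitBadTwoLowerHalfOfFacts/STUB_IDEAS_…_3_g43.lean`
  §4b) with rate constant `1`. Proof: `Λ(e) = Λ(⟨κ_vσ⟩_v) · Λ(y)` with every component of `y` above `p`
  equal to `1` (at `v`) or a principal unit of depth `p^N` (`hdeep`), so `‖Λ(y) − 1‖ ≤ p^{−N}` factor by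
  factor (`norm_map_sub_one_le`, ultrametric unit algebra of the `…Local` file).

The degree-one reading (`K_v ≅ ℚ_p`: the stand-in is `(e_p(κσ) : ℂ_p)^{pp w₀}`) is the sibling
`PrintCf2RubinValueTwoAvatarOnRayDegreeOne.lean`.

## References

* [deShalit1987] E. de Shalit, *Iwasawa theory of elliptic curves with complex multiplication* (1987),
  II.4.13 (p. 69), II.4.14 (38) (p. 72).
* [SerreAbelianLadic1968] J.-P. Serre, *Abelian ℓ-adic representations and elliptic curves* (1968),
  Ch. II §2.7, Ch. III §1.1, §2.3.
-/

noncomputable section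

namespace Summit.BirchSwinnertonDyer.BirchSwinnertonDyer.Theorems.PrintCf2.AvatarOnRay

open scoped NumberField Topology nonZeroDivisors
open NumberField IsDedekindDomain IsDedekindDomain.HeightOneSpectrum Field
open Literature.NumberTheory.EllipticCurves Literature.NumberTheory.GaloisRepresentations
open Literature.NumberTheory.NumberFields

set_option linter.dupNamespace false -- D-0017: single-problem summit, `…BirchSwinnertonDyer.BirchSwinnertonDyer…` repeats a namespace by design
set_option autoImplicit false

variable {p : ℕ} [Fact p.Prime] {K : Type} [Field K] [NumberField K]

/-! ### §1. `‖Λ(x)‖ = 1` on unit ideles; the stand-in `Λ(⟨u⟩_v)⁻¹` as a product over local embeddings -/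

section AlgPart

variable {v : HeightOneSpectrum (𝓞 K)}

/-- `‖Λ(x)‖ = 1` when the components of `x` above `p` are local units. [cite: SerreAbelianLadic1968, Ch. III §1.1] -/
theorem norm_coe_algPart_eq_one (ι : PadicAlgCl p ≃+* ℂ) (pp qq : InfinitePlace K → ℤ) {x : ideleGroup K}
    (hx : ∀ w : HeightOneSpectrum (𝓞 K), ((p : ℕ) : 𝓞 K) ∈ w.asIdeal →
      Valued.v ((x : AdeleRing (𝓞 K) K).2 w) = 1) :
    ‖(PadicEmbedding.algPart ι pp qq x : PadicAlgCl p)‖ = 1 := by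
  rw [PadicEmbedding.algPart_apply, Units.coe_prod, norm_prod]
  refine Finset.prod_eq_one fun e _ => ?_
  rw [Units.val_zpow_eq_zpow_val, norm_zpow, PadicEmbedding.PlaceEmb.coe_eval,
    norm_map_eq_one_of_valued_eq_one e.1.2 e.2.1 e.2.2 (hx _ e.1.2), one_zpow]

/-- **The stand-in is an explicit algebraic character of `u`**: `Λ(⟨u⟩_v)⁻¹ = ∏_{emb} emb(u)^{n_emb}` over
the continuous embeddings `emb : K_v → ℚ̄_p`, `n_emb = embExponent pp qq (ι ∘ emb ∘ ι_v)`.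
[cite: SerreAbelianLadic1968, Ch. III §1.1, §2.3] -/
theorem coe_algPart_inv_localUnits_eq_prod (ι : PadicAlgCl p ≃+* ℂ) (pp qq : InfinitePlace K → ℤ)
    (hvp : ((p : ℕ) : 𝓞 K) ∈ v.asIdeal) (u : (v.adicCompletionIntegers K)ˣ) :
    (((PadicEmbedding.algPart ι pp qq (localUnits v
        (Units.map ((v.adicCompletionIntegers K).subtype : _ →* _) u)))⁻¹ : (PadicAlgCl p)ˣ) : PadicAlgCl p) =
      ∏ f : {e : v.adicCompletion K →+* PadicAlgCl p // Continuous e},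
        f.1 ((u : v.adicCompletionIntegers K) : v.adicCompletion K) ^
          HeckeCharacter.embExponent pp qq
            ((ι : PadicAlgCl p →+* ℂ).comp (f.1.comp (algebraMap K (v.adicCompletion K)))) := by
  classical
  rw [Units.val_inv_eq_inv_val, HeckeCharacter.coe_algPart_localUnits ι hvp, ← Finset.prod_inv_distrib]
  refine Finset.prod_congr rfl fun f _ => ?_
  rw [← zpow_neg, neg_neg]
  rfl

end AlgPart

/-! ### §2. The arithmetic half of (38): `φ̂(σ) ≡ Λ(⟨κσ⟩_v)⁻¹ (mod p^N)` on `Gal(K̄/K(𝔪))` -/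

section Bound

variable [IsTotallyComplex K] {φ : HeckeCharacter K} {pp qq : InfinitePlace K → ℤ}
  {T : Finset (HeightOneSpectrum (𝓞 K))} {c : HeightOneSpectrum (𝓞 K) → ℕ} {𝔪 : Ideal (𝓞 K)}
  {v : HeightOneSpectrum (𝓞 K)}

/-- ★★ **THE ARITHMETIC HALF OF DE SHALIT'S (38) — the avatar is the one-variable stand-in up to
`p^{−N}` on the ray subgroup.** `K` totally complex, `φ` of infinity type `(pp, qq)` with module of
definition `(T, c) ≤ 𝔪` (`hle`), `r` ANY `p`-adic avatar of `φ`, `v ∤ 𝔪` with `w_𝔪 = 1`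
(`κ = rayAdicCharacter h𝔪 hv hw : Gal(K̄/K(𝔪)) → 𝒪_vˣ`), and `𝔪` deep enough at every OTHER place
`w ∣ p`: `exp(−ord_w 𝔪) ≤ |p^N|_w` (`hdeep`). Then for every `σ ∈ Gal(K̄/K(𝔪))`

  `‖avatarValueAt r σ − Λ(⟨κσ⟩_v)⁻¹‖ ≤ (p⁻¹)^N`.

From the tree's exact value `avatarValueAt_eq_of_mem_ker_rayClassField` (`φ̂(σ) = (ι⁻¹(φ ⟨κσ⟩_v)·Λ(e))⁻¹`,
here `φ ⟨κσ⟩_v = 1` by `(T, c) ≤ 𝔪`): `Λ(e) = Λ(⟨κσ⟩_v)·Λ(y)` with the components of `y = ⟨κσ⟩_v⁻¹·e`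
above `p` equal to `1` (at `v`, since `e_v = κσ`) or to principal units of depth `p^N` (`hdeep`), so
`‖Λ(y) − 1‖ ≤ p^{−N}` factor by factor. [cite: deShalit1987, II.4.14 (38) (p. 72), II.4.13 (p. 69)]
[cite: SerreAbelianLadic1968, Ch. III §2.3] -/
theorem norm_avatarValueAt_sub_algPart_inv_localUnits_le (ι : PadicAlgCl p ≃+* ℂ)
    (hinf : φ.HasInfinityType pp qq) (hmod : φ.IsModulus T c)
    {r : FramedGaloisRep K (PadicAlgCl p) 1} (hav : IsPAdicAvatarOf ι φ r)
    (hle : ∀ w ∈ T, (c w : ℤ) ≤ FractionalIdeal.count K w (𝔪 : FractionalIdeal (𝓞 K)⁰ K))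
    (h𝔪 : 𝔪 ≠ ⊥) (hv : ¬ 𝔪 ≤ v.asIdeal) (hw : ∀ u : (𝓞 K)ˣ, (u : 𝓞 K) - 1 ∈ 𝔪 → u = 1) {N : ℕ}
    (hdeep : ∀ w : HeightOneSpectrum (𝓞 K), ((p : ℕ) : 𝓞 K) ∈ w.asIdeal → w ≠ v →
      WithZero.exp (-FractionalIdeal.count K w (𝔪 : FractionalIdeal (𝓞 K)⁰ K)) ≤
        Valued.v (algebraMap K (w.adicCompletion K) ((p : K) ^ N)))
    (σ : ↥(absRestrictNormalHom (rayClassField K 𝔪)).ker) :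
    ‖avatarValueAt r σ -
        ((((PadicEmbedding.algPart ι pp qq (localUnits v
            (Units.map ((v.adicCompletionIntegers K).subtype : _ →* _)
              (rayAdicCharacter h𝔪 hv hw σ))))⁻¹ : (PadicAlgCl p)ˣ) : PadicAlgCl p) : ℂ_[p])‖ ≤
      ((p : ℝ)⁻¹) ^ N := by
  classical
  obtain ⟨x, hx, -, -, hcomp, hval⟩ :=
    avatarValueAt_eq_of_mem_ker_rayClassField h𝔪 hv hw hinf ι hav hmod (fun w hw' _ => hle w hw') σ
  set κu : (v.adicCompletionIntegers K)ˣ := rayAdicCharacter h𝔪 hv hw σ with hκu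
  set cc : ideleGroup K := localUnits v (Units.map ((v.adicCompletionIntegers K).subtype : _ →* _) κu)
    with hcc
  set Λ := PadicEmbedding.algPart (K := K) ι pp qq with hΛ
  -- `φ(⟨κσ⟩_v) = 1`: the unit idele at `v ∤ 𝔪` lies in `W_𝔪`, killed by the module of definition
  have hφ1 : φ cc = 1 := HeckeCharacter.eq_one_of_mem_rayUnitIdeles hmod hle
    (localUnits_integer_mem_rayUnitIdeles h𝔪 hv κu) (infPart_localUnits v _)
  rw [hval, hφ1, Units.val_one, map_one, one_mul]
  -- components of `x`, `cc`, `y = cc⁻¹ x`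
  have hunit : ∀ w, Valued.v ((x : AdeleRing (𝓞 K) K).2 w) = 1 := valued_snd_eq_one_of_mem_rayUnitIdeles hx
  have hxv : (x : AdeleRing (𝓞 K) K).2 v = ((κu : v.adicCompletionIntegers K) : v.adicCompletion K) :=
    hcomp v hv
  have hc_self : ∀ w, w = v → (cc : AdeleRing (𝓞 K) K).2 w = (x : AdeleRing (𝓞 K) K).2 w := by
    rintro w rfl
    rw [hcc, localUnits_integer_snd_self, hxv]
  have hc_ne : ∀ w, w ≠ v → (cc : AdeleRing (𝓞 K) K).2 w = 1 := fun w h => by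
    rw [hcc, localUnits_snd_apply_of_ne _ h]
  have hy_self : ∀ w, w = v → ((cc⁻¹ * x : ideleGroup K) : AdeleRing (𝓞 K) K).2 w = 1 := by
    intro w h
    have h0 : (x : AdeleRing (𝓞 K) K).2 w ≠ 0 := fun h' => by
      have h1 := hunit w; rw [h', map_zero] at h1; exact zero_ne_one h1
    rw [ideleGroup_val_snd_mul, ideleGroup_val_inv_snd, hc_self w h, inv_mul_cancel₀ h0]
  have hy_ne : ∀ w, w ≠ v → ((cc⁻¹ * x : ideleGroup K) : AdeleRing (𝓞 K) K).2 w =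
      (x : AdeleRing (𝓞 K) K).2 w := fun w h => by
    rw [ideleGroup_val_snd_mul, ideleGroup_val_inv_snd, hc_ne w h, inv_one, one_mul]
  have hΛx : Λ x = Λ cc * Λ (cc⁻¹ * x) := by rw [← map_mul, mul_inv_cancel_left]
  have hΛc1 : ‖(Λ cc : PadicAlgCl p)‖ = 1 := by
    refine norm_coe_algPart_eq_one ι pp qq fun w _ => ?_
    by_cases h : w = v
    · rw [hc_self w h]; exact hunit w
    · rw [hc_ne w h, map_one]
  have hΛy1 : ‖(Λ (cc⁻¹ * x) : PadicAlgCl p)‖ = 1 := by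
    refine norm_coe_algPart_eq_one ι pp qq fun w _ => ?_
    by_cases h : w = v
    · rw [hy_self w h, map_one]
    · rw [hy_ne w h]; exact hunit w
  have hpN : (0 : ℝ) ≤ ((p : ℝ)⁻¹) ^ N := by positivity
  have hΛy : ‖(Λ (cc⁻¹ * x) : PadicAlgCl p) - 1‖ ≤ ((p : ℝ)⁻¹) ^ N := by
    rw [hΛ, PadicEmbedding.algPart_apply, Units.coe_prod]
    refine norm_prod_sub_one_le _ _ hpN (fun f _ => ?_) (fun f _ => ?_)
    · rw [Units.val_zpow_eq_zpow_val, norm_zpow, PadicEmbedding.PlaceEmb.coe_eval]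
      by_cases h : (f.1.1 : HeightOneSpectrum (𝓞 K)) = v
      · rw [hy_self _ h, map_one, norm_one, one_zpow]
      · rw [hy_ne _ h, norm_map_eq_one_of_valued_eq_one f.1.2 f.2.1 f.2.2 (hunit _), one_zpow]
    · rw [Units.val_zpow_eq_zpow_val, PadicEmbedding.PlaceEmb.coe_eval]
      by_cases h : (f.1.1 : HeightOneSpectrum (𝓞 K)) = v
      · rw [hy_self _ h, map_one, one_zpow, sub_self, norm_zero]; exact hpN
      · rw [hy_ne _ h]
        exact norm_zpow_sub_one_le (norm_map_eq_one_of_valued_eq_one f.1.2 f.2.1 f.2.2 (hunit _))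
          (norm_map_sub_one_le f.1.2 f.2.1 f.2.2
            (((mem_rayUnitIdeles_iff x).mp hx _).2.trans (hdeep _ f.1.2 h))) _
  -- assemble in `ℚ̄_p`, then read in `ℂ_p`
  have key : ((Λ x : PadicAlgCl p))⁻¹ - (((Λ cc)⁻¹ : (PadicAlgCl p)ˣ) : PadicAlgCl p) =
      (((Λ cc)⁻¹ : (PadicAlgCl p)ˣ) : PadicAlgCl p) *
        ((((Λ (cc⁻¹ * x))⁻¹ : (PadicAlgCl p)ˣ) : PadicAlgCl p) - 1) := by
    rw [hΛx, Units.val_mul, mul_inv, Units.val_inv_eq_inv_val, Units.val_inv_eq_inv_val, mul_sub, mul_one]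
  rw [← UniformSpace.Completion.coe_sub, PadicComplex.norm_extends, key, norm_mul,
    Units.val_inv_eq_inv_val, Units.val_inv_eq_inv_val, norm_inv, hΛc1, inv_one, one_mul,
    norm_inv_sub_one_eq hΛy1]
  exact hΛy

end Bound

end Summit.BirchSwinnertonDyer.BirchSwinnertonDyer.Theorems.PrintCf2.AvatarOnRay

end
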